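import Literature.AlgebraicGeometry.Motives.HodgeLieOfAbelianVarietyBiproduct
import Literature.AlgebraicGeometry.Motives.HodgeLieSemisimpleTimesAbelian
import Literature.AlgebraicGeometry.HodgeTheory.BettiOneHodgeStructureModelIndependence
import HarnessLib

/-!
# `dim Lie Hg(H¹(X₁ × X₂)) = dim Lie Hg(H¹X₁) + dim Lie Hg(H¹X₂)` when `Hg(X₁)` is semisimple and `X₂` is of CM type
# (Moonen–Zarhin 1999 Thm. (3.2)(2) for the Lie algebras, without condition (D))

Family `hodge`, layer `Literature/AlgebraicGeometry/Motives`; THEOREMS ONLY (no definition, no named fact).  Written for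
the cell `pub-hodgecm2` (COR-CM), seat `b27` gen 43 (count-neutral Mumford–Tate-rank ladder).  The complex-abelian-variety
form of `Motives/HodgeLieSemisimpleTimesAbelian` (`𝔥(H₁ ⊕ H₂) = 𝔥(H₁) × 𝔥(H₂)` for `𝔥(H₁)` centre-free and `𝔥(H₂)`
abelian), for a complex abelian variety `X` presented as `X₁ × X₂` by a BICONE `p_i : X → X_i`, `i_i : X_i → X`
(`i_i p_i = 𝟙`, `p₁ i₁ + p₂ i₂ = 𝟙`; e.g. `X₁ ⊞ X₂`, `X₁.prod X₂`): the pull-backs `p_i^*`, `i_i^*` decompose the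
Betti Hodge structure `H¹(X) = p₁^* H¹(X₁) ⊕ p₂^* H¹(X₂)` (`H¹` is an additive functor:
`bettiCohomology_map_add_one/comp_hom/id_hom`).

PRINTED RESULT.  Moonen–Zarhin, Math. Ann. 315 (1999) §3 Thm. (3.2)(2) (after Hazama 1989): «Suppose `X₁` has no factors
of Type 4 and `X₂` is of CM-type. Then […] `Hg(X₁ × X₂) = Hg(X₁) × Hg(X₂)`» [corpus: paper:arxiv-math_9901113 p. 6].
Here «no factors of Type 4» enters as «`Lie Hg(H¹X₁) ∩ End⁰ = 0`» (semisimple Hodge group, ibid. (2.2)–(2.3)) and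
«CM-type» as «`Lie Hg(H¹X₂)` is commutative» (ibid. §1: `Hg(X)` is a torus iff `X` is of CM type); the CorCM layer
translates `HasNoTypeIVFactor` / `IsOfCMType` (`CorCM/MumfordTateRankSemisimpleTimesCM`).

* **`finrank_hodgeLie_hodge_one_eq_add_of_bicone`** — `dim_ℚ Lie Hg(H¹X) = dim_ℚ Lie Hg(H¹X₁) + dim_ℚ Lie Hg(H¹X₂)`;
* `finrank_hodgeLie_hodge_one_biprod_eq_add`, `finrank_hodgeLie_hodge_one_prod_eq_add` — for `X₁ ⊞ X₂` and `X₁.prod X₂`;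
* `finrank_hodgeLie_hodge_one_eq_add_of_isIsogenous_prod` — for every `X ∼ X₁ × X₂`.

## References
* [MoonenZarhin1999LowDim] B. Moonen, Yu. Zarhin, *Hodge classes on abelian varieties of low dimension*, Math. Ann. 315
  (1999), §3 (3.1), Thm. (3.2)(2) [corpus: paper:arxiv-math_9901113 p. 6]. [cite: MoonenZarhin1999LowDim, §3 Thm. (3.2)(2)]
* [Hazama1989] F. Hazama, *Algebraic cycles on nonsimple abelian varieties*, Duke Math. J. 58 (1989) 31–37.
  [cite: Hazama1989, Thm. (= Gordon 7.6.2)]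
* [VoisinHodgeI2002] C. Voisin, *Hodge Theory and Complex Algebraic Geometry I*, §7.3.2 and Thm. 11.38 (Künneth).
  [cite: VoisinHodgeI2002, §7.3.2]
* [Deligne1982HodgeCycles] P. Deligne, *Hodge cycles on abelian varieties*, LNM 900 (1982), I §3.1 and Prop. 3.4.
  [cite: Deligne1982HodgeCycles, I §3.1 and Prop. 3.4]
-/

noncomputable section

open CategoryTheory CategoryTheory.Limits

namespace Literature.AlgebraicGeometry.Motives

namespace AbelianVariety

open Literature.AlgebraicGeometry.HodgeTheory
open Literature.AlgebraicGeometry.Motives.HodgeStructure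
open Literature.AlgebraicGeometry.ComplexMultiplication

/-! ### §1 `H¹` of a bicone `X ≅ X₁ × X₂` -/

section Bicone

variable {X X₁ X₂ : AbelianVariety ℂ} (p₁ : X ⟶ X₁) (i₁ : X₁ ⟶ X) (p₂ : X ⟶ X₂) (i₂ : X₂ ⟶ X)

/-- `i^* p^* = id` on `H¹(X_i)` for `i ≫ p = 𝟙`. [cite: VoisinHodgeI2002, §7.3.2] -/
theorem pull_pull_eq_self_of_comp_eq_id {Y : AbelianVariety ℂ} {p : X ⟶ Y} {i : Y ⟶ X} (h : i ≫ p = 𝟙 Y)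
    (x : bettiCohomology Y.X 1) :
    BettiUniverse.pull i.hom.hom.hom 1 (BettiUniverse.pull p.hom.hom.hom 1 x) = x := by
  have h' := bettiCohomology_map_comp_hom i p 1
  rw [h, bettiCohomology_map_id_hom] at h'
  have e := congrArg (fun φ => ModuleCat.Hom.hom φ x) h'
  dsimp only at e
  rw [ModuleCat.hom_comp, LinearMap.comp_apply] at e
  exact e.symm

/-- `p₁^* i₁^* + p₂^* i₂^* = id` on `H¹(X)` for `p₁ i₁ + p₂ i₂ = 𝟙` (`H¹` is additive). [cite: VoisinHodgeI2002, §7.3.2] -/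
theorem pull_pull_add_pull_pull_eq_self (hsum : p₁ ≫ i₁ + p₂ ≫ i₂ = 𝟙 X) (x : bettiCohomology X.X 1) :
    BettiUniverse.pull p₁.hom.hom.hom 1 (BettiUniverse.pull i₁.hom.hom.hom 1 x) +
      BettiUniverse.pull p₂.hom.hom.hom 1 (BettiUniverse.pull i₂.hom.hom.hom 1 x) = x := by
  have h' := bettiCohomology_map_add_one (p₁ ≫ i₁) (p₂ ≫ i₂)
  rw [hsum, bettiCohomology_map_id_hom, bettiCohomology_map_comp_hom, bettiCohomology_map_comp_hom] at h'
  have e := congrArg (fun φ => ModuleCat.Hom.hom φ x) h'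
  dsimp only at e
  rw [ModuleCat.hom_id, LinearMap.id_apply, ModuleCat.hom_add, LinearMap.add_apply, ModuleCat.hom_comp,
    ModuleCat.hom_comp, LinearMap.comp_apply, LinearMap.comp_apply] at e
  exact e.symm

end Bicone

/-! ### §2 The dimension of `Lie Hg(H¹(X₁ × X₂))` -/

section Main

variable [HodgeTensorFacts.{0, 0}]
  {X X₁ X₂ : AbelianVariety ℂ} {n n₁ n₂ : ℕ} (hX : IsSmoothProjective n X.X) (hX₁ : IsSmoothProjective n₁ X₁.X)
  (hX₂ : IsSmoothProjective n₂ X₂.X)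

/-- **`dim_ℚ Lie Hg(H¹X) = dim_ℚ Lie Hg(H¹X₁) + dim_ℚ Lie Hg(H¹X₂)` for a bicone `X ≅ X₁ × X₂`** (`i_k p_k = 𝟙`,
`p₁ i₁ + p₂ i₂ = 𝟙`) **with `Lie Hg(H¹X₁)` centre-free (`Lie Hg ∩ End⁰(X₁) = 0`, i.e. `Hg(X₁)` semisimple / no factor of
type IV) and `Lie Hg(H¹X₂)` commutative (`X₂` of CM type)** — Moonen–Zarhin's Thm. (3.2)(2)
`Hg(X₁ × X₂) = Hg(X₁) × Hg(X₂)` at the level of Lie algebras, WITHOUT condition (D): the abstract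
`HodgeStructure.finrank_hodgeLie_eq_add_of_centerFree_of_abelian` for the retracts `p_k^*`, `i_k^*` of the Betti Hodge
structures. [cite: MoonenZarhin1999LowDim, §3 Thm. (3.2)(2)] [cite: Hazama1989, Thm. (= Gordon 7.6.2)]
[cite: VoisinHodgeI2002, §7.3.2] -/
theorem finrank_hodgeLie_hodge_one_eq_add_of_bicone (p₁ : X ⟶ X₁) (i₁ : X₁ ⟶ X) (p₂ : X ⟶ X₂) (i₂ : X₂ ⟶ X)
    (h₁ : i₁ ≫ p₁ = 𝟙 X₁) (h₂ : i₂ ≫ p₂ = 𝟙 X₂) (hsum : p₁ ≫ i₁ + p₂ ≫ i₂ = 𝟙 X)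
    (hz₁ : haveI := BettiUniverse.finite hX₁ 1
      (BettiUniverse.hodge exists_isReal_hodgeModel_holds hX₁ 1).hodgeLie ⊓
        Subalgebra.toSubmodule (BettiUniverse.hodge exists_isReal_hodgeModel_holds hX₁ 1).endAlg = ⊥)
    (hab₂ : haveI := BettiUniverse.finite hX₂ 1
      ∀ A ∈ (BettiUniverse.hodge exists_isReal_hodgeModel_holds hX₂ 1).hodgeLie,
        ∀ B ∈ (BettiUniverse.hodge exists_isReal_hodgeModel_holds hX₂ 1).hodgeLie, A * B = B * A) :
    haveI := BettiUniverse.finite hX 1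
    haveI := BettiUniverse.finite hX₁ 1
    haveI := BettiUniverse.finite hX₂ 1
    Module.finrank ℚ (BettiUniverse.hodge exists_isReal_hodgeModel_holds hX 1).hodgeLie =
      Module.finrank ℚ (BettiUniverse.hodge exists_isReal_hodgeModel_holds hX₁ 1).hodgeLie +
        Module.finrank ℚ (BettiUniverse.hodge exists_isReal_hodgeModel_holds hX₂ 1).hodgeLie := by
  haveI := BettiUniverse.finite hX 1
  haveI := BettiUniverse.finite hX₁ 1
  haveI := BettiUniverse.finite hX₂ 1
  obtain ⟨ψ⟩ := BettiUniverse.hodge_isPolarizable exists_isReal_hodgeModel_holds hX 1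
  exact finrank_hodgeLie_eq_add_of_centerFree_of_abelian
    (BettiUniverse.pullHodgeHom exists_isReal_hodgeModel_holds hodgePQ_independent_of_hodgeModel_holds hX hX₁
      p₁.hom.hom.hom 1)
    (BettiUniverse.pullHodgeHom exists_isReal_hodgeModel_holds hodgePQ_independent_of_hodgeModel_holds hX₁ hX
      i₁.hom.hom.hom 1)
    (BettiUniverse.pullHodgeHom exists_isReal_hodgeModel_holds hodgePQ_independent_of_hodgeModel_holds hX hX₂
      p₂.hom.hom.hom 1)
    (BettiUniverse.pullHodgeHom exists_isReal_hodgeModel_holds hodgePQ_independent_of_hodgeModel_holds hX₂ hX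
      i₂.hom.hom.hom 1)
    (fun v => pull_pull_eq_self_of_comp_eq_id h₁ v) (fun v => pull_pull_eq_self_of_comp_eq_id h₂ v)
    (fun v => pull_pull_add_pull_pull_eq_self p₁ i₁ p₂ i₂ hsum v) ψ hz₁ hab₂

/-- **`dim Lie Hg(H¹(X₁ ⊞ X₂)) = dim Lie Hg(H¹X₁) + dim Lie Hg(H¹X₂)`** for the biproduct, `Lie Hg(H¹X₁)` centre-free,
`Lie Hg(H¹X₂)` commutative. [cite: MoonenZarhin1999LowDim, §3 Thm. (3.2)(2)] [cite: Hazama1989, Thm. (= Gordon 7.6.2)] -/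
theorem finrank_hodgeLie_hodge_one_biprod_eq_add {m : ℕ} (hP : IsSmoothProjective m (X₁ ⊞ X₂).X)
    (hz₁ : haveI := BettiUniverse.finite hX₁ 1
      (BettiUniverse.hodge exists_isReal_hodgeModel_holds hX₁ 1).hodgeLie ⊓
        Subalgebra.toSubmodule (BettiUniverse.hodge exists_isReal_hodgeModel_holds hX₁ 1).endAlg = ⊥)
    (hab₂ : haveI := BettiUniverse.finite hX₂ 1
      ∀ A ∈ (BettiUniverse.hodge exists_isReal_hodgeModel_holds hX₂ 1).hodgeLie,
        ∀ B ∈ (BettiUniverse.hodge exists_isReal_hodgeModel_holds hX₂ 1).hodgeLie, A * B = B * A) :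
    haveI := BettiUniverse.finite hP 1
    haveI := BettiUniverse.finite hX₁ 1
    haveI := BettiUniverse.finite hX₂ 1
    Module.finrank ℚ (BettiUniverse.hodge exists_isReal_hodgeModel_holds hP 1).hodgeLie =
      Module.finrank ℚ (BettiUniverse.hodge exists_isReal_hodgeModel_holds hX₁ 1).hodgeLie +
        Module.finrank ℚ (BettiUniverse.hodge exists_isReal_hodgeModel_holds hX₂ 1).hodgeLie :=
  finrank_hodgeLie_hodge_one_eq_add_of_bicone hP hX₁ hX₂ biprod.fst biprod.inl biprod.snd biprod.inr
    biprod.inl_fst biprod.inr_snd biprod.total hz₁ hab₂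

/-- **`dim Lie Hg(H¹(X₁.prod X₂)) = dim Lie Hg(H¹X₁) + dim Lie Hg(H¹X₂)`** for the product abelian variety
(`AbelianVariety.prod`, bicone `fst`, `snd`, `prodLift 𝟙 0`, `prodLift 0 𝟙`), `Lie Hg(H¹X₁)` centre-free, `Lie Hg(H¹X₂)`
commutative. [cite: MoonenZarhin1999LowDim, §3 Thm. (3.2)(2)] [cite: Hazama1989, Thm. (= Gordon 7.6.2)] -/
theorem finrank_hodgeLie_hodge_one_prod_eq_add {m : ℕ} (hP : IsSmoothProjective m (X₁.prod X₂).X)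
    (hz₁ : haveI := BettiUniverse.finite hX₁ 1
      (BettiUniverse.hodge exists_isReal_hodgeModel_holds hX₁ 1).hodgeLie ⊓
        Subalgebra.toSubmodule (BettiUniverse.hodge exists_isReal_hodgeModel_holds hX₁ 1).endAlg = ⊥)
    (hab₂ : haveI := BettiUniverse.finite hX₂ 1
      ∀ A ∈ (BettiUniverse.hodge exists_isReal_hodgeModel_holds hX₂ 1).hodgeLie,
        ∀ B ∈ (BettiUniverse.hodge exists_isReal_hodgeModel_holds hX₂ 1).hodgeLie, A * B = B * A) :
    haveI := BettiUniverse.finite hP 1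
    haveI := BettiUniverse.finite hX₁ 1
    haveI := BettiUniverse.finite hX₂ 1
    Module.finrank ℚ (BettiUniverse.hodge exists_isReal_hodgeModel_holds hP 1).hodgeLie =
      Module.finrank ℚ (BettiUniverse.hodge exists_isReal_hodgeModel_holds hX₁ 1).hodgeLie +
        Module.finrank ℚ (BettiUniverse.hodge exists_isReal_hodgeModel_holds hX₂ 1).hodgeLie := by
  refine finrank_hodgeLie_hodge_one_eq_add_of_bicone hP hX₁ hX₂ (fst X₁ X₂) (prodLift (𝟙 X₁) 0) (snd X₁ X₂)
    (prodLift 0 (𝟙 X₂)) (prodLift_fst _ _) (prodLift_snd _ _) ?_ hz₁ hab₂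
  refine prod_hom_ext ?_ ?_
  · rw [Preadditive.add_comp, Category.assoc, Category.assoc, prodLift_fst, prodLift_fst, Category.comp_id,
      comp_zero, add_zero, Category.id_comp]
  · rw [Preadditive.add_comp, Category.assoc, Category.assoc, prodLift_snd, prodLift_snd, Category.comp_id,
      comp_zero, zero_add, Category.id_comp]

/-- **`dim Lie Hg(H¹X) = dim Lie Hg(H¹X₁) + dim Lie Hg(H¹X₂)` for every complex abelian variety `X` isogenous to
`X₁.prod X₂`**, `Lie Hg(H¹X₁)` centre-free, `Lie Hg(H¹X₂)` commutative (isogeny invariance of `dim Lie Hg`,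
`finrank_hodgeLie_hodge_one_eq_of_isIsogenous`). [cite: MoonenZarhin1999LowDim, §3 Thm. (3.2)(2)]
[cite: Hazama1989, Thm. (= Gordon 7.6.2)] -/
theorem finrank_hodgeLie_hodge_one_eq_add_of_isIsogenous_prod (h : IsIsogenous X (X₁.prod X₂))
    (hz₁ : haveI := BettiUniverse.finite hX₁ 1
      (BettiUniverse.hodge exists_isReal_hodgeModel_holds hX₁ 1).hodgeLie ⊓
        Subalgebra.toSubmodule (BettiUniverse.hodge exists_isReal_hodgeModel_holds hX₁ 1).endAlg = ⊥)
    (hab₂ : haveI := BettiUniverse.finite hX₂ 1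
      ∀ A ∈ (BettiUniverse.hodge exists_isReal_hodgeModel_holds hX₂ 1).hodgeLie,
        ∀ B ∈ (BettiUniverse.hodge exists_isReal_hodgeModel_holds hX₂ 1).hodgeLie, A * B = B * A) :
    haveI := BettiUniverse.finite hX 1
    haveI := BettiUniverse.finite hX₁ 1
    haveI := BettiUniverse.finite hX₂ 1
    Module.finrank ℚ (BettiUniverse.hodge exists_isReal_hodgeModel_holds hX 1).hodgeLie =
      Module.finrank ℚ (BettiUniverse.hodge exists_isReal_hodgeModel_holds hX₁ 1).hodgeLie +
        Module.finrank ℚ (BettiUniverse.hodge exists_isReal_hodgeModel_holds hX₂ 1).hodgeLie := by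
  have hP : IsSmoothProjective (X₁.prod X₂).dim (X₁.prod X₂).X := AbelianVariety.isSmoothProjective_holds
  rw [finrank_hodgeLie_hodge_one_eq_of_isIsogenous hX hP h]
  exact finrank_hodgeLie_hodge_one_prod_eq_add hX₁ hX₂ hP hz₁ hab₂

end Main

end AbelianVariety

end Literature.AlgebraicGeometry.Motives

end
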